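import Summits.QuantumFields.YangMills.Theorems.SoloBlindOddTorusLogConvex
import Literature.MathematicalPhysics.QuantumFieldTheory.SpeciesTimeReflection
import HarnessLib

/-!
# Mixed time correlations on odd tori: the OS Schwarz inequality
# (solo-QuantumFields-blind, rung D8, part 5)

Parts 1–4 concern the DIAGONAL `A = B` of the summit's lattice correlator.  `HasLatticeMassGap`
quantifies over PAIRS `A, B`; on the time-zero spatial algebra the pair correlator is controlled by
the two diagonal ones through the Schwarz inequality of the Osterwalder–Seiler form.  On the odd
torus `(ℤ/L)^d`, `L = 2m + 1 ≥ 3`, with `M_{F,G}(s) = ⟨F · G(· + s e₀)⟩`: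

* `timeTwoPtMixed_swap`, `timeTwoPtMixed_neg` — `M_{G,F}(s) = M_{F,G}(-s) = M_{F,G}(s)` for
  time-zero spatial `F, G` (translation invariance, and invariance of Wilson's measure under the
  site reflection `Θ'`, tree `integral_comp_negReflect_eq`);
* `timeTwoPtMixed_schwarz` — `M_{F,G}(t + t' - 1)² ≤ T_F(2t - 1) · T_G(2t' - 1)` for slices
  `1 ≤ t, t' ≤ m + 1` (`β ≥ 0`);
* `timeTwoPtMixedSeq_sq_le_of_geometric` — consequently, geometric bounds `T_F(n) ≤ K_F θⁿ`,
  `T_G(n) ≤ K_G θⁿ` on `0 ≤ n ≤ m` (`0 < θ ≤ 1`) give `θ · M_{F,G}(n)² ≤ K_F K_G θ^{2n}` on the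
  same range: decay of the two autocorrelations transfers to the mixed correlator at the SAME
  rate (odd separations `n = 2t - 1` directly, even ones `n = 2t` from the slices `t, t + 1` and
  the symmetry `T(L - n) = T(n)` at the edge `n = m`).

The summit-native, scheme-level consequence (the `HasLatticeMassGap` clause for a pair of
time-zero spatial species follows from ANTIPODAL decay of the two diagonal correlators) is in the
sequel.

References: K. Osterwalder, E. Seiler, Ann. Phys. 110 (1978) 440, §2; E. Seiler, LNP 159 (1982)
Ch. 2; J. Glimm, A. Jaffe, *Quantum Physics* (1987) §6.1. [folklore consequences of OS
positivity; the typed odd-torus statements are this unit's]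
-/

open MeasureTheory
open Literature.MathematicalPhysics.QuantumFieldTheory

noncomputable section

namespace Summit.QuantumFields.YangMills.Theorems.SoloBlind

variable {d L N : ℕ} [NeZero d] [NeZero L] {G : Type*} [Group G] [TopologicalSpace G]
  [IsTopologicalGroup G] [CompactSpace G] [MeasurableSpace G] [BorelSpace G]
  (ρ : G →* Matrix (Fin N) (Fin N) ℂ)

/-- The **mixed time correlation** `M_{F,G}(s) = ⟨F · G(· + s e₀)⟩_{Λ,β}` on the torus
`(ℤ/L)^d` (`timeTwoPt ρ β F = timeTwoPtMixed ρ β F F`). [folklore] -/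
def timeTwoPtMixed (β : ℝ) (F F₂ : GaugeConfig d L G → ℝ) (s : ZMod L) : ℝ :=
  wilsonExpectation ρ β fun U =>
    F U * F₂ (torusConfigShift (-(Pi.single (0 : Fin d) s : Site d L)) U)

/-- The mixed correlation as a sequence in the separation `n : ℕ`. [folklore] -/
def timeTwoPtMixedSeq (β : ℝ) (F F₂ : GaugeConfig d L G → ℝ) (n : ℕ) : ℝ :=
  timeTwoPtMixed ρ β F F₂ (n : ZMod L)

/-- Translates: `⟨F(· + a e₀) G(· + b e₀)⟩ = M_{F,G}(b - a)` (translation invariance). [folklore] -/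
theorem wilsonExpectation_translate_mul_translate₂ (β : ℝ) (F F₂ : GaugeConfig d L G → ℝ)
    (a b : ZMod L) :
    wilsonExpectation ρ β (fun U =>
        F (torusConfigShift (-(Pi.single (0 : Fin d) a : Site d L)) U) *
          F₂ (torusConfigShift (-(Pi.single (0 : Fin d) b : Site d L)) U)) =
      timeTwoPtMixed ρ β F F₂ (b - a) := by
  unfold timeTwoPtMixed
  rw [← wilsonExpectation_comp_torusConfigShift ρ β (-(Pi.single (0 : Fin d) a : Site d L))
    (fun U => F U * F₂ (torusConfigShift (-(Pi.single (0 : Fin d) (b - a) : Site d L)) U))]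
  have hv : -(Pi.single (0 : Fin d) (b - a) : Site d L) + -(Pi.single (0 : Fin d) a : Site d L) =
      -(Pi.single (0 : Fin d) b : Site d L) := by
    rw [← neg_add, ← Pi.single_add, sub_add_cancel]
  have hcomp : ∀ V : GaugeConfig d L G,
      torusConfigShift (-(Pi.single (0 : Fin d) (b - a) : Site d L))
          (torusConfigShift (-(Pi.single (0 : Fin d) a : Site d L)) V) =
        torusConfigShift (-(Pi.single (0 : Fin d) b : Site d L)) V := fun V => by
    funext e
    simp only [torusConfigShift_apply, sub_sub, hv]
  congr 1
  funext U
  simp only [Function.comp_apply, hcomp]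

/-- Swapping the observables reverses the separation: `M_{G,F}(s) = M_{F,G}(-s)`. [folklore] -/
theorem timeTwoPtMixed_swap (β : ℝ) (F F₂ : GaugeConfig d L G → ℝ) (s : ZMod L) :
    timeTwoPtMixed ρ β F₂ F s = timeTwoPtMixed ρ β F F₂ (-s) := by
  have h := wilsonExpectation_translate_mul_translate₂ ρ β F F₂ s 0
  rw [zero_sub] at h
  rw [← h]
  have h0 : ∀ U : GaugeConfig d L G,
      torusConfigShift (-(Pi.single (0 : Fin d) (0 : ZMod L) : Site d L)) U = U := fun U => by
    funext e
    simp [torusConfigShift_apply]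
  unfold timeTwoPtMixed
  congr 1
  funext U
  rw [h0, mul_comm]

omit [NeZero L] [TopologicalSpace G] [IsTopologicalGroup G] [CompactSpace G] [MeasurableSpace G]
  [BorelSpace G] in
/-- A time-zero spatial observable is invariant under the site reflection `Θ'`. [folklore] -/
theorem timeZero_negReflect {F : GaugeConfig d L G → ℝ}
    (hF0 : DependsOn F {e : Edge d L | e.1 0 = 0 ∧ e.2 ≠ 0}) (U : GaugeConfig d L G) :
    F U.negReflect = F U := by
  apply hF0
  rintro e ⟨he0, he2⟩
  simp only [GaugeConfig.negReflect, he2, if_false]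
  congr 2
  funext k
  by_cases hk : k = 0
  · subst hk
    simp [he0]
  · exact WilsonSiteRP.negReflect_apply_of_ne _ hk

omit [NeZero L] [TopologicalSpace G] [IsTopologicalGroup G] [CompactSpace G] [BorelSpace G] in
/-- `Θ'` reverses time translates of a time-zero spatial observable: `(G_s)(Θ'U) = G_{-s}(U)`.
[folklore] -/
theorem timeZero_translate_negReflect {F : GaugeConfig d L G → ℝ}
    (hF0 : DependsOn F {e : Edge d L | e.1 0 = 0 ∧ e.2 ≠ 0}) (s : ZMod L) (U : GaugeConfig d L G) :
    F (torusConfigShift (-(Pi.single (0 : Fin d) s : Site d L)) U.negReflect) =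
      F (torusConfigShift (-(Pi.single (0 : Fin d) (-s) : Site d L)) U) := by
  apply hF0
  rintro e ⟨he0, he2⟩
  simp only [torusConfigShift_apply, GaugeConfig.negReflect, he2, if_false]
  congr 2
  funext k
  by_cases hk : k = 0
  · subst hk
    simp [he0]
  · simp [WilsonSiteRP.negReflect_apply_of_ne _ hk, hk]

/-- **Reflection symmetry of the mixed correlation**: `M_{F,G}(-s) = M_{F,G}(s)` for time-zero
spatial `F, G` (invariance of Wilson's measure under `Θ'`, continuous `ρ`). [folklore] -/
theorem timeTwoPtMixed_neg (hρ : Continuous ρ) (β : ℝ) {F F₂ : GaugeConfig d L G → ℝ}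
    (hF0 : DependsOn F {e : Edge d L | e.1 0 = 0 ∧ e.2 ≠ 0})
    (hG0 : DependsOn F₂ {e : Edge d L | e.1 0 = 0 ∧ e.2 ≠ 0}) (s : ZMod L) :
    timeTwoPtMixed ρ β F F₂ (-s) = timeTwoPtMixed ρ β F F₂ s := by
  unfold timeTwoPtMixed wilsonExpectation
  rw [← integral_comp_negReflect_eq ρ hρ β]
  congr 1
  funext U
  simp only [timeZero_negReflect hF0, timeZero_translate_negReflect hG0, neg_neg]

/-- Symmetry of the mixed sequence: `M(L - n) = M(n)` for `n ≤ L`. [folklore] -/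
theorem timeTwoPtMixedSeq_symm (hρ : Continuous ρ) (β : ℝ) {F F₂ : GaugeConfig d L G → ℝ}
    (hF0 : DependsOn F {e : Edge d L | e.1 0 = 0 ∧ e.2 ≠ 0})
    (hG0 : DependsOn F₂ {e : Edge d L | e.1 0 = 0 ∧ e.2 ≠ 0}) {n : ℕ} (hn : n ≤ L) :
    timeTwoPtMixedSeq ρ β F F₂ (L - n) = timeTwoPtMixedSeq ρ β F F₂ n := by
  unfold timeTwoPtMixedSeq
  rw [Nat.cast_sub hn, ZMod.natCast_self, zero_sub, timeTwoPtMixed_neg ρ hρ β hF0 hG0]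

/-- **OS Schwarz inequality for a pair of time-zero spatial observables** on the odd torus:
`M_{F,G}(t + t' - 1)² ≤ T_F(2t - 1) · T_G(2t' - 1)` for slices `1 ≤ t, t' ≤ L/2 + 1`
(`L ≥ 3` odd, `β ≥ 0`, compact `G`, continuous `ρ`). [folklore: Schwarz inequality of the OS form] -/
theorem timeTwoPtMixed_schwarz (hL : Odd L) (hL3 : 3 ≤ L) (hρ : Continuous ρ) {β : ℝ}
    (hβ : 0 ≤ β) {F F₂ : GaugeConfig d L G → ℝ} (hFm : Measurable F)
    (hFb : ∃ C : ℝ, ∀ U, |F U| ≤ C) (hF0 : DependsOn F {e : Edge d L | e.1 0 = 0 ∧ e.2 ≠ 0})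
    (hGm : Measurable F₂) (hGb : ∃ C : ℝ, ∀ U, |F₂ U| ≤ C)
    (hG0 : DependsOn F₂ {e : Edge d L | e.1 0 = 0 ∧ e.2 ≠ 0}) {t t' : ZMod L}
    (ht1 : 1 ≤ t.val) (ht2 : t.val ≤ L / 2 + 1) (ht'1 : 1 ≤ t'.val) (ht'2 : t'.val ≤ L / 2 + 1) :
    (timeTwoPtMixed ρ β F F₂ (t + t' - 1)) ^ 2 ≤
      timeTwoPt ρ β F (2 * t - 1) * timeTwoPt ρ β F₂ (2 * t' - 1) := by
  haveI := isProbabilityMeasure_wilsonMeasure (d := d) (L := L) (G := G) ρ hρ β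
  obtain ⟨CF, hCF⟩ := hFb
  obtain ⟨CG, hCG⟩ := hGb
  have hC : ∀ U, |F U| ≤ max CF CG := fun U => (hCF U).trans (le_max_left _ _)
  have hC' : ∀ U, |F₂ U| ≤ max CF CG := fun U => (hCG U).trans (le_max_right _ _)
  have hC0 : 0 ≤ max CF CG := le_trans (abs_nonneg _) (hC (fun _ => 1))
  have hτF : ∀ s : ZMod L, Measurable fun U : GaugeConfig d L G =>
      F (torusConfigShift (-(Pi.single (0 : Fin d) s : Site d L)) U) :=
    fun s => hFm.comp (torusConfigShift _).measurable
  have hτG : ∀ s : ZMod L, Measurable fun U : GaugeConfig d L G =>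
      F₂ (torusConfigShift (-(Pi.single (0 : Fin d) s : Site d L)) U) :=
    fun s => hGm.comp (torusConfigShift _).measurable
  -- integrability of the four products
  have hI : ∀ {P Q : GaugeConfig d L G → ℝ}, Measurable P → Measurable Q →
      (∀ U, |P U| ≤ max CF CG) → (∀ U, |Q U| ≤ max CF CG) →
      Integrable (fun U => P U * Q U) (wilsonMeasure ρ β) := by
    intro P Q hPm hQm hP hQ
    refine Integrable.of_bound (hPm.mul hQm).aestronglyMeasurable (max CF CG * max CF CG)
      (ae_of_all _ fun U => ?_)
    rw [Real.norm_eq_abs, abs_mul]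
    exact mul_le_mul (hP _) (hQ _) (abs_nonneg _) hC0
  have hquad : ∀ lam : ℝ, 0 ≤ timeTwoPt ρ β F₂ (2 * t' - 1) * (lam * lam) +
      (2 * timeTwoPtMixed ρ β F F₂ (t + t' - 1)) * lam + timeTwoPt ρ β F (2 * t - 1) := by
    intro lam
    set P : GaugeConfig d L G → ℝ := fun U =>
      F (torusConfigShift (-(Pi.single (0 : Fin d) t : Site d L)) U) +
        lam * F₂ (torusConfigShift (-(Pi.single (0 : Fin d) t' : Site d L)) U) with hP
    have hPm : Measurable P := (hτF t).add ((hτG t').const_mul lam)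
    have hPb : ∃ C' : ℝ, ∀ U, |P U| ≤ C' := by
      refine ⟨max CF CG + |lam| * max CF CG, fun U => ?_⟩
      rw [hP]
      calc |F (torusConfigShift (-(Pi.single (0 : Fin d) t : Site d L)) U) +
              lam * F₂ (torusConfigShift (-(Pi.single (0 : Fin d) t' : Site d L)) U)|
          ≤ |F (torusConfigShift (-(Pi.single (0 : Fin d) t : Site d L)) U)| +
              |lam * F₂ (torusConfigShift (-(Pi.single (0 : Fin d) t' : Site d L)) U)| :=
            abs_add_le _ _
        _ = |F (torusConfigShift (-(Pi.single (0 : Fin d) t : Site d L)) U)| +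
              |lam| * |F₂ (torusConfigShift (-(Pi.single (0 : Fin d) t' : Site d L)) U)| := by
            rw [abs_mul]
        _ ≤ max CF CG + |lam| * max CF CG := by gcongr; exacts [hC _, hC' _]
    have hPdep : DependsOn P
        ((WilsonOddRP.oPosEdges ∪ WilsonOddRP.oSharedEdges : Finset (Edge d L)) :
          Set (Edge d L)) := fun U V hUV => by
      simp only [hP, dependsOn_timeZero_translate hF0 ht1 ht2 hUV,
        dependsOn_timeZero_translate hG0 ht'1 ht'2 hUV]
    have hRP := wilsonExpectation_odd_centred_timeReflect_mul_nonneg ρ hL hL3 hρ hβ hPm hPb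
      hPdep 0
    simp only [sub_zero] at hRP
    have hexp : (fun U => P U.timeReflect * P U) = fun U =>
        F (torusConfigShift (-(Pi.single (0 : Fin d) (1 - t) : Site d L)) U) *
            F (torusConfigShift (-(Pi.single (0 : Fin d) t : Site d L)) U) +
          lam * (F (torusConfigShift (-(Pi.single (0 : Fin d) (1 - t) : Site d L)) U) *
            F₂ (torusConfigShift (-(Pi.single (0 : Fin d) t' : Site d L)) U)) +
          lam * (F₂ (torusConfigShift (-(Pi.single (0 : Fin d) (1 - t') : Site d L)) U) *
            F (torusConfigShift (-(Pi.single (0 : Fin d) t : Site d L)) U)) +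
          lam * lam * (F₂ (torusConfigShift (-(Pi.single (0 : Fin d) (1 - t') : Site d L)) U) *
            F₂ (torusConfigShift (-(Pi.single (0 : Fin d) t' : Site d L)) U)) := by
      funext U
      simp only [hP, timeZero_translate_timeReflect hF0 t U, timeZero_translate_timeReflect hG0 t' U]
      ring
    rw [hexp] at hRP
    have i1 : Integrable (fun U : GaugeConfig d L G =>
        F (torusConfigShift (-(Pi.single (0 : Fin d) (1 - t) : Site d L)) U) *
          F (torusConfigShift (-(Pi.single (0 : Fin d) t : Site d L)) U)) (wilsonMeasure ρ β) :=
      hI (hτF (1 - t)) (hτF t) (fun U => hC _) (fun U => hC _)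
    have i2 : Integrable (fun U : GaugeConfig d L G => lam *
        (F (torusConfigShift (-(Pi.single (0 : Fin d) (1 - t) : Site d L)) U) *
          F₂ (torusConfigShift (-(Pi.single (0 : Fin d) t' : Site d L)) U)))
        (wilsonMeasure ρ β) :=
      (hI (hτF (1 - t)) (hτG t') (fun U => hC _) (fun U => hC' _)).const_mul lam
    have i3 : Integrable (fun U : GaugeConfig d L G => lam *
        (F₂ (torusConfigShift (-(Pi.single (0 : Fin d) (1 - t') : Site d L)) U) *
          F (torusConfigShift (-(Pi.single (0 : Fin d) t : Site d L)) U)))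
        (wilsonMeasure ρ β) :=
      (hI (hτG (1 - t')) (hτF t) (fun U => hC' _) (fun U => hC _)).const_mul lam
    have i4 : Integrable (fun U : GaugeConfig d L G => lam * lam *
        (F₂ (torusConfigShift (-(Pi.single (0 : Fin d) (1 - t') : Site d L)) U) *
          F₂ (torusConfigShift (-(Pi.single (0 : Fin d) t' : Site d L)) U)))
        (wilsonMeasure ρ β) :=
      (hI (hτG (1 - t')) (hτG t') (fun U => hC' _) (fun U => hC' _)).const_mul (lam * lam)
    have i12 : Integrable (fun U : GaugeConfig d L G =>
        F (torusConfigShift (-(Pi.single (0 : Fin d) (1 - t) : Site d L)) U) *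
            F (torusConfigShift (-(Pi.single (0 : Fin d) t : Site d L)) U) +
          lam * (F (torusConfigShift (-(Pi.single (0 : Fin d) (1 - t) : Site d L)) U) *
            F₂ (torusConfigShift (-(Pi.single (0 : Fin d) t' : Site d L)) U)))
        (wilsonMeasure ρ β) := i1.add i2
    have i123 : Integrable (fun U : GaugeConfig d L G =>
        F (torusConfigShift (-(Pi.single (0 : Fin d) (1 - t) : Site d L)) U) *
            F (torusConfigShift (-(Pi.single (0 : Fin d) t : Site d L)) U) +
          lam * (F (torusConfigShift (-(Pi.single (0 : Fin d) (1 - t) : Site d L)) U) *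
            F₂ (torusConfigShift (-(Pi.single (0 : Fin d) t' : Site d L)) U)) +
          lam * (F₂ (torusConfigShift (-(Pi.single (0 : Fin d) (1 - t') : Site d L)) U) *
            F (torusConfigShift (-(Pi.single (0 : Fin d) t : Site d L)) U)))
        (wilsonMeasure ρ β) := i12.add i3
    unfold wilsonExpectation at hRP
    beta_reduce at hRP
    rw [integral_add i123 i4, integral_add i12 i3, integral_add i1 i2, integral_const_mul,
      integral_const_mul, integral_const_mul] at hRP
    have e1 := wilsonExpectation_translate_mul_translate ρ β F (1 - t) t
    have e2 := wilsonExpectation_translate_mul_translate₂ ρ β F F₂ (1 - t) t'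
    have e3 := wilsonExpectation_translate_mul_translate₂ ρ β F₂ F (1 - t') t
    have e4 := wilsonExpectation_translate_mul_translate ρ β F₂ (1 - t') t'
    rw [timeTwoPtMixed_swap, timeTwoPtMixed_neg ρ hρ β hF0 hG0] at e3
    unfold wilsonExpectation at e1 e2 e3 e4
    rw [e1, e2, e3, e4] at hRP
    have s1 : t - (1 - t) = 2 * t - 1 := by ring
    have s2 : t' - (1 - t) = t + t' - 1 := by ring
    have s3 : t - (1 - t') = t + t' - 1 := by ring
    have s4 : t' - (1 - t') = 2 * t' - 1 := by ring
    rw [s1, s2, s3, s4] at hRP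
    nlinarith [hRP]
  have hd := discrim_le_zero hquad
  rw [discrim] at hd
  nlinarith [hd]

/-- **Transfer of geometric decay to the mixed correlator.**  On the odd torus `L = 2m + 1 ≥ 3`
(`β ≥ 0`, `F, G` time-zero spatial, bounded, measurable): if `T_F(n) ≤ K_F θⁿ` and
`T_G(n) ≤ K_G θⁿ` for `0 ≤ n ≤ m` with `0 < θ ≤ 1`, then `θ · M_{F,G}(n)² ≤ K_F K_G θ^{2n}` for
`0 ≤ n ≤ m`. [this unit's; elementary from the OS Schwarz inequality] -/
theorem timeTwoPtMixedSeq_sq_le_of_geometric (hL : Odd L) (hL3 : 3 ≤ L) (hρ : Continuous ρ)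
    {β : ℝ} (hβ : 0 ≤ β) {F F₂ : GaugeConfig d L G → ℝ} (hFm : Measurable F)
    (hFb : ∃ C : ℝ, ∀ U, |F U| ≤ C) (hF0 : DependsOn F {e : Edge d L | e.1 0 = 0 ∧ e.2 ≠ 0})
    (hGm : Measurable F₂) (hGb : ∃ C : ℝ, ∀ U, |F₂ U| ≤ C)
    (hG0 : DependsOn F₂ {e : Edge d L | e.1 0 = 0 ∧ e.2 ≠ 0}) {θ KF KG : ℝ} (hθ : 0 < θ)
    (hθ1 : θ ≤ 1) (hKF : ∀ n, n ≤ L / 2 → timeTwoPtSeq ρ β F n ≤ KF * θ ^ n)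
    (hKG : ∀ n, n ≤ L / 2 → timeTwoPtSeq ρ β F₂ n ≤ KG * θ ^ n) {n : ℕ} (hn : n ≤ L / 2) :
    θ * timeTwoPtMixedSeq ρ β F F₂ n ^ 2 ≤ KF * KG * θ ^ (2 * n) := by
  obtain ⟨m, hm⟩ := hL
  have hdiv : L / 2 = m := by omega
  -- non-negativity of the constants (from `T ≥ 0` at `n = 0`)
  have hTF0 : 0 ≤ timeTwoPtSeq ρ β F 0 := timeTwoPt_nonneg ρ ⟨m, hm⟩ hL3 hρ hβ hFm hFb hF0 _
  have hTG0 : 0 ≤ timeTwoPtSeq ρ β F₂ 0 := timeTwoPt_nonneg ρ ⟨m, hm⟩ hL3 hρ hβ hGm hGb hG0 _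
  have hKF0 : 0 ≤ KF := by have := hKF 0 (Nat.zero_le _); simp at this; linarith
  have hKG0 : 0 ≤ KG := by have := hKG 0 (Nat.zero_le _); simp at this; linarith
  have hTG : ∀ k, 0 ≤ timeTwoPtSeq ρ β F₂ k := fun k =>
    timeTwoPt_nonneg ρ ⟨m, hm⟩ hL3 hρ hβ hGm hGb hG0 _
  have hTF : ∀ k, 0 ≤ timeTwoPtSeq ρ β F k := fun k =>
    timeTwoPt_nonneg ρ ⟨m, hm⟩ hL3 hρ hβ hFm hFb hF0 _
  -- the Schwarz inequality in sequence form, slices `i, i'`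
  have key : ∀ i i' : ℕ, 1 ≤ i → i ≤ m + 1 → 1 ≤ i' → i' ≤ m + 1 →
      timeTwoPtMixedSeq ρ β F F₂ (i + i' - 1) ^ 2 ≤
        timeTwoPtSeq ρ β F (2 * i - 1) * timeTwoPtSeq ρ β F₂ (2 * i' - 1) := by
    intro i i' hi1 hi2 hi'1 hi'2
    have hiL : i < L := by omega
    have hi'L : i' < L := by omega
    have hv : ((i : ℕ) : ZMod L).val = i := by rw [ZMod.val_natCast, Nat.mod_eq_of_lt hiL]
    have hv' : ((i' : ℕ) : ZMod L).val = i' := by rw [ZMod.val_natCast, Nat.mod_eq_of_lt hi'L]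
    have h := timeTwoPtMixed_schwarz ρ ⟨m, hm⟩ hL3 hρ hβ hFm hFb hF0 hGm hGb hG0
      (t := ((i : ℕ) : ZMod L)) (t' := ((i' : ℕ) : ZMod L)) (by rw [hv]; exact hi1)
      (by rw [hv]; omega) (by rw [hv']; exact hi'1) (by rw [hv']; omega)
    have c1 : ((i : ℕ) : ZMod L) + ((i' : ℕ) : ZMod L) - 1 = ((i + i' - 1 : ℕ) : ZMod L) := by
      rw [Nat.cast_sub (by omega : 1 ≤ i + i')]; push_cast; ring
    have c2 : 2 * ((i : ℕ) : ZMod L) - 1 = ((2 * i - 1 : ℕ) : ZMod L) := by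
      rw [Nat.cast_sub (by omega : 1 ≤ 2 * i)]; push_cast; ring
    have c3 : 2 * ((i' : ℕ) : ZMod L) - 1 = ((2 * i' - 1 : ℕ) : ZMod L) := by
      rw [Nat.cast_sub (by omega : 1 ≤ 2 * i')]; push_cast; ring
    rw [c1, c2, c3] at h
    exact h
  have hsq0 : 0 ≤ timeTwoPtMixedSeq ρ β F F₂ n ^ 2 := sq_nonneg _
  have hθn : 0 ≤ θ ^ n := pow_nonneg hθ.le _
  rcases Nat.even_or_odd n with ⟨i, hi⟩ | ⟨i, hi⟩
  · rcases Nat.eq_zero_or_pos i with h0 | hpos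
    · -- `n = 0`: realised as the odd separation `L = 2(m+1) - 1`
      subst h0
      have hn0 : n = 0 := by omega
      subst hn0
      have h := key (m + 1) (m + 1) (by omega) le_rfl (by omega) le_rfl
      have e1 : m + 1 + (m + 1) - 1 = L := by omega
      have e2 : 2 * (m + 1) - 1 = L := by omega
      rw [e1, e2] at h
      have hL0 : timeTwoPtMixedSeq ρ β F F₂ L = timeTwoPtMixedSeq ρ β F F₂ 0 := by
        have := timeTwoPtMixedSeq_symm ρ hρ β hF0 hG0 (n := 0) (Nat.zero_le L)
        simpa using this
      have hF0' : timeTwoPtSeq ρ β F L = timeTwoPtSeq ρ β F 0 := by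
        have := timeTwoPtSeq_symm ρ β F (n := 0) (Nat.zero_le L); simpa using this
      have hG0' : timeTwoPtSeq ρ β F₂ L = timeTwoPtSeq ρ β F₂ 0 := by
        have := timeTwoPtSeq_symm ρ β F₂ (n := 0) (Nat.zero_le L); simpa using this
      rw [hL0, hF0', hG0'] at h
      have hA := hKF 0 (Nat.zero_le _)
      have hB := hKG 0 (Nat.zero_le _)
      simp only [pow_zero, mul_one, Nat.mul_zero] at hA hB ⊢
      calc θ * timeTwoPtMixedSeq ρ β F F₂ 0 ^ 2 ≤ 1 * timeTwoPtMixedSeq ρ β F F₂ 0 ^ 2 :=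
            mul_le_mul_of_nonneg_right hθ1 hsq0
        _ ≤ timeTwoPtSeq ρ β F 0 * timeTwoPtSeq ρ β F₂ 0 := by rw [one_mul]; exact h
        _ ≤ KF * KG := mul_le_mul hA hB hTG0 hKF0
    · -- `n = 2i`, `1 ≤ i ≤ m`: slices `i, i+1`
      have h := key i (i + 1) (by omega) (by omega) (by omega) (by omega)
      have e1 : i + (i + 1) - 1 = n := by omega
      have e2 : 2 * i - 1 = n - 1 := by omega
      have e3 : 2 * (i + 1) - 1 = n + 1 := by omega
      rw [e1, e2, e3] at h
      have hA := hKF (n - 1) (by omega)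
      -- `T_G(n+1) ≤ K_G θ^n`: inside the range by monotonicity of `θ^k`, at the edge by symmetry
      have hB : timeTwoPtSeq ρ β F₂ (n + 1) ≤ KG * θ ^ n := by
        rcases Nat.lt_or_ge (n + 1) (L / 2 + 1) with hlt | hge
        · calc timeTwoPtSeq ρ β F₂ (n + 1) ≤ KG * θ ^ (n + 1) := hKG (n + 1) (by omega)
            _ ≤ KG * θ ^ n := by
                apply mul_le_mul_of_nonneg_left _ hKG0
                exact pow_le_pow_of_le_one hθ.le hθ1 (Nat.le_succ n)
        · have hnm : n = m := by omega
          have hs := timeTwoPtSeq_symm ρ β F₂ (n := n + 1) (by omega : n + 1 ≤ L)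
          have e4 : L - (n + 1) = n := by omega
          rw [e4] at hs
          rw [← hs]
          exact hKG n hn
      have hn1 : n - 1 + 1 = n := by omega
      have hpow : θ ^ (n - 1) * θ ^ n * θ = θ ^ (2 * n) := by
        calc θ ^ (n - 1) * θ ^ n * θ = θ ^ (n - 1 + 1) * θ ^ n := by ring
          _ = θ ^ (2 * n) := by rw [hn1, ← pow_add]; congr 1; omega
      calc θ * timeTwoPtMixedSeq ρ β F F₂ n ^ 2
          ≤ θ * (timeTwoPtSeq ρ β F (n - 1) * timeTwoPtSeq ρ β F₂ (n + 1)) :=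
            mul_le_mul_of_nonneg_left h hθ.le
        _ ≤ θ * (KF * θ ^ (n - 1) * (KG * θ ^ n)) :=
            mul_le_mul_of_nonneg_left (mul_le_mul hA hB (hTG _)
              (mul_nonneg hKF0 (pow_nonneg hθ.le _))) hθ.le
        _ = KF * KG * (θ ^ (n - 1) * θ ^ n * θ) := by ring
        _ = KF * KG * θ ^ (2 * n) := by rw [hpow]
  · -- `n = 2i + 1`: slices `i+1, i+1`
    have h := key (i + 1) (i + 1) (by omega) (by omega) (by omega) (by omega)
    have e1 : i + 1 + (i + 1) - 1 = n := by omega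
    have e2 : 2 * (i + 1) - 1 = n := by omega
    rw [e1, e2] at h
    have hA := hKF n hn
    have hB := hKG n hn
    have hpow : θ ^ n * θ ^ n = θ ^ (2 * n) := by rw [← pow_add]; congr 1; omega
    calc θ * timeTwoPtMixedSeq ρ β F F₂ n ^ 2 ≤ 1 * timeTwoPtMixedSeq ρ β F F₂ n ^ 2 :=
          mul_le_mul_of_nonneg_right hθ1 hsq0
      _ ≤ timeTwoPtSeq ρ β F n * timeTwoPtSeq ρ β F₂ n := by rw [one_mul]; exact h
      _ ≤ KF * θ ^ n * (KG * θ ^ n) := mul_le_mul hA hB (hTG _) (mul_nonneg hKF0 hθn)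
      _ = KF * KG * θ ^ (2 * n) := by rw [← hpow]; ring

end Summit.QuantumFields.YangMills.Theorems.SoloBlind

end
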